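import Summits.QuantumFields.YangMills.Theorems.BalabanUVNodesN09LocalSupportSetAtRecord
import Literature.MathematicalPhysics.QuantumFieldTheory.Balaban1983to89.Node00.SmallFieldChi29SelOfRecord

/-!
# NODE N09 [B12] · THRESHOLD-CUT DENSITIES ARE CONTINUOUS OFF THE THRESHOLDS OF AN ARBITRARY CRITICAL LETTER, and bounded on closed sets inside the domain:
# FILE 1∕3's LOCAL continuity clause `hρc` and boundedness clause `hρC` with the minimiser selection a PARAMETER; Sel edition by instance

Cell `pub-ymgap` (YM-PLAN Track A), DAG node N09 [Balaban1987RG1] (= [I]); width seat `pub-ymgap-dag-n09-w3` g6, FILE 5; count-neutral helper keyed to K1⁹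
`StabilityBRunRowsAtRecordR13SepCoPHV` = stmt-QuantumFields-27364 (`--kind proof --supports … --as helper`).

WHY.  dag-n09-w2 g5's `…N09BetaInputContinuousOffChi29Thresholds` proves the continuity of the record's β-input off the (2.9) thresholds for the BARE choice
(`fluctDevOfRecord`, `chiFix29OfRecord`), and FILE 2 §4–§5 of this generation re-key it to FILE 1's LOCAL shapes.  FILES 3–4 made road B's ENGINE and SUPPORT SET
selection-generic; THIS FILE completes the kit with the CONTINUITY and BOUNDEDNESS clauses for an arbitrary letter `crit : (coarse) → (fine)` and an arbitrary density of the (0.19)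
form `ρ = χ·exp[−GF∕g² + A]` whose cut-off `χ ∈ {0,1}` is `1` exactly where every non-distinguished threshold of `crit` is below `ε₁` (two implication hypotheses `hχ1`∕`hχ0`,
no defining `if`): off the thresholds `χ` is LOCALLY CONSTANT at every `U` at which `V ↦ crit(Ū V)` is continuous (finitely many strict inequalities of continuous functions,
none attained), hence `ρ` is continuous there; on a CLOSED set inside a region where `GF`, `A` are continuous, `ρ` is BOUNDED (compactness of `SU(N)^{bonds}`).  The Sel
edition (`crit := critCfgSelOfRecord`, `χ := chiFix29SelOfRecord`, `ρ := betaInputOfRecord T (chiFixed29Sel ν ε₁) K g k`) is an instance — its `hcrit` ON THE DOMAIN is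
dag-n09-w1 g6's `hcritSel_domAlt_of_thm1_εbg_of_reg8`; NO record reads the Sel objects yet (K0c∕dag-n09-w4 g2's OFFER).

WHAT IS PROVED (theorems only; 0 def, 0 sorry; axioms standard).
§1 `continuousAt_dev_of_continuousAt_crit`, `eventually_forall_dev_lt_iff`, ★★ `eventuallyEq_cut_of_forall_ne` (χ locally constant off the thresholds), ★★ `continuousAt_density_of_forall_ne`.
§2 ★★★ `hρc_local_of_continuousOn_crit` — FILE 1∕3's `hρc` VERBATIM: `∀ U ∈ K₀, Ū U ∈ D → (no non-distinguished threshold of crit active at U) → ContinuousAt ρ U` from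
   `ContinuousOn crit D` (`D` open), `GF`∕`A` continuous on an open `Dk ⊇ K₀`, `K₀` in the loop α-guard (`α < δ_N`); ★★ `hρC_of_cut_le_one_of_continuousOn` — FILE 1∕3's `hρC`.
§3 Sel edition: `hρc_betaInput_chi29Sel_local_of_continuousOn_crit`, `hρC_betaInput_chi29Sel_of_continuousOn`.

HONEST SCOPE ∕ FRAMING.  LOCATED, count-neutral topology BY NAME (dag-n09-w4's averaging continuity, compactness of the configuration space, K0c's Sel faces); `hcrit` on the
domain, `GF`∕`A` continuity (the tower), `K₀` DISPLAYED; NO record edition made or proposed; NOTHING of Bałaban's asserted; `hreg`∕(F3)∕`contTOn` NOT discharged; N09 NOT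
discharged; conjunct 1 (Lemma 4) ∕ FLAG №7 untouched; K0⁷ ∕ K1⁹ ∕ K2⁹ ∕ K3⁸ NOT closed; counts unmoved (typed 28∕28 · discharged 5∕28); one finite four-torus programme at fixed
`ε = L^{−K}` per run — R4 closes the conditional rung `BalabanLadder.UV` only; NOT ℝ⁴ ∕ infinite volume ∕ OS; the Yang–Mills mass gap (Clay) is NOT proved by any of this.
-/

noncomputable section

open scoped Matrix.Norms.L2Operator Topology
open Filter Set Function MeasureTheory

namespace Summit.QuantumFields.YangMills.BalabanUVNodes.N09DensityContinuousOffThresholdsAnyCrit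

open Literature.MathematicalPhysics.QuantumFieldTheory.Balaban1983to89
open Literature.MathematicalPhysics.QuantumFieldTheory.Balaban1983to89.T4Continuum (T4Family)
open Literature.MathematicalPhysics.QuantumFieldTheory.Balaban1983to89.Node00
open Literature.MathematicalPhysics.QuantumFieldTheory.Balaban1983to89.BlockAveraging (Small Idx loopHol)
open Literature.MathematicalPhysics.QuantumFieldTheory.Balaban1983to89.BlockAveragingHaarAC (centralBond)
open Literature.MathematicalPhysics.QuantumFieldTheory.Balaban1983to89.ExpMeanLog (deltaSU expMeanLogSU)
open Literature.MathematicalPhysics.QuantumFieldTheory.Balaban1983to89.B12ContinuousTransportInvarianceOn (continuous_dist1_SU)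
open Summit.QuantumFields.YangMills.BalabanUVNodes.N09ChartReadAveragingSmooth (continuousAt_avgFun_of_small)
open Summit.QuantumFields.YangMills.BalabanUVNodes.N09BetaInputContinuousOffChi29Thresholds (not_isB0_iff)

variable {F : T4Family} {N : ℕ} [NeZero N] {K k : ℕ}

/-! ## §1 Off the thresholds of an arbitrary letter the cut-off is locally constant -/

section Generic

variable (crit : GaugeField (F.P K) (k + 1) (SU N) → GaugeField (F.P K) k (SU N))

/-- **The deviation `V ↦ dist1 (crit(Ū V)(b)⁻¹·V(b))` is continuous at `U` as soon as `V ↦ crit(Ū V)` is** (`dist1`, inversion, multiplication continuous on `SU(N)`).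
[cite: Balaban1987RG1, (2.3) p.265 and (2.9) p.266 (bookkeeping)] -/
theorem continuousAt_dev_of_continuousAt_crit {U : GaugeField (F.P K) k (SU N)} (b : PBond (F.P K) k)
    (hcrit : ContinuousAt (fun V : GaugeField (F.P K) k (SU N) => crit ((avOfRecord F N K k).avg V)) U) :
    ContinuousAt (fun V : GaugeField (F.P K) k (SU N) => dist1 ((crit ((avOfRecord F N K k).avg V) b)⁻¹ * V b)) U :=
  continuous_dist1_SU.continuousAt.comp (((continuous_apply b).continuousAt.comp hcrit).inv.mul (continuous_apply b).continuousAt)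

/-- **The conjunction of the strict non-distinguished thresholds is locally constant at a configuration where none is attained** (finitely many bonds; each strict inequality of
a function continuous at `U` and `≠ ε₁` there is locally constant). [cite: Balaban1987RG1, (2.9) p.266 (bookkeeping)] -/
theorem eventually_forall_dev_lt_iff {ε₁ : ℝ} {U : GaugeField (F.P K) k (SU N)}
    (hcrit : ContinuousAt (fun V : GaugeField (F.P K) k (SU N) => crit ((avOfRecord F N K k).avg V)) U)
    (hne : ∀ b : PBond (F.P K) k, ¬ IsB0 b → dist1 ((crit ((avOfRecord F N K k).avg U) b)⁻¹ * U b) ≠ ε₁) :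
    ∀ᶠ V in 𝓝 U, ((∀ b : PBond (F.P K) k, ¬ IsB0 b → dist1 ((crit ((avOfRecord F N K k).avg V) b)⁻¹ * V b) < ε₁) ↔
      (∀ b : PBond (F.P K) k, ¬ IsB0 b → dist1 ((crit ((avOfRecord F N K k).avg U) b)⁻¹ * U b) < ε₁)) := by
  have hall : ∀ᶠ V in 𝓝 U, ∀ b : PBond (F.P K) k, ¬ IsB0 b →
      (dist1 ((crit ((avOfRecord F N K k).avg V) b)⁻¹ * V b) < ε₁ ↔ dist1 ((crit ((avOfRecord F N K k).avg U) b)⁻¹ * U b) < ε₁) := by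
    refine eventually_all.2 fun b => ?_
    by_cases hb : IsB0 b
    · exact Eventually.of_forall fun V h => absurd hb h
    · have hc := continuousAt_dev_of_continuousAt_crit crit b hcrit
      rcases lt_or_gt_of_ne (hne b hb) with hlt | hgt
      · filter_upwards [hc.eventually_mem (Iio_mem_nhds hlt)] with V hV
        exact fun _ => ⟨fun _ => hlt, fun _ => hV⟩
      · filter_upwards [hc.eventually_mem (Ioi_mem_nhds hgt)] with V hV
        exact fun _ => ⟨fun h => absurd h (not_lt.2 (le_of_lt (α := ℝ) hV)), fun h => absurd h (not_lt.2 hgt.le)⟩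
  filter_upwards [hall] with V hV
  exact ⟨fun h b hb => (hV b hb).1 (h b hb), fun h b hb => (hV b hb).2 (h b hb)⟩

variable {crit}

/-- ★★ **A 0∕1 CUT-OFF AT THE THRESHOLDS OF `crit` IS LOCALLY CONSTANT OFF THE THRESHOLDS**: `χ = 1` where all non-distinguished thresholds are below `ε₁`, `χ = 0` elsewhere
(hypotheses `hχ1`∕`hχ0`), `V ↦ crit(Ū V)` continuous at `U`, no threshold attained at `U` ⇒ `χ =ᶠ[𝓝 U] χ U`. [cite: Balaban1987RG1, (2.9) p.266] -/
theorem eventuallyEq_cut_of_forall_ne {ε₁ : ℝ} {χ : Density (F.P K) k (SU N)}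
    (hχ1 : ∀ V, (∀ b : PBond (F.P K) k, ¬ IsB0 b → dist1 ((crit ((avOfRecord F N K k).avg V) b)⁻¹ * V b) < ε₁) → χ V = 1)
    (hχ0 : ∀ V, ¬ (∀ b : PBond (F.P K) k, ¬ IsB0 b → dist1 ((crit ((avOfRecord F N K k).avg V) b)⁻¹ * V b) < ε₁) → χ V = 0)
    {U : GaugeField (F.P K) k (SU N)} (hcrit : ContinuousAt (fun V : GaugeField (F.P K) k (SU N) => crit ((avOfRecord F N K k).avg V)) U)
    (hne : ∀ b : PBond (F.P K) k, ¬ IsB0 b → dist1 ((crit ((avOfRecord F N K k).avg U) b)⁻¹ * U b) ≠ ε₁) :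
    χ =ᶠ[𝓝 U] fun _ => χ U := by
  filter_upwards [eventually_forall_dev_lt_iff crit hcrit hne] with V hV
  by_cases h : ∀ b : PBond (F.P K) k, ¬ IsB0 b → dist1 ((crit ((avOfRecord F N K k).avg V) b)⁻¹ * V b) < ε₁
  · rw [hχ1 V h, hχ1 U (hV.1 h)]
  · rw [hχ0 V h, hχ0 U fun h' => h (hV.2 h')]

/-- ★★ **A (0.19)-SHAPED DENSITY `ρ = χ·exp[−GF∕g² + A]` CUT AT THE THRESHOLDS OF `crit` IS CONTINUOUS AT EVERY CONFIGURATION WITH NO ACTIVE THRESHOLD** at which `V ↦ crit(Ū V)`,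
`GF` and `A` are continuous. [cite: Balaban1987RG1, (0.19) p.255 and (2.9) p.266] -/
theorem continuousAt_density_of_forall_ne {ε₁ gk : ℝ} {χ GF A ρ : Density (F.P K) k (SU N)}
    (hρ : ∀ V, ρ V = χ V * Real.exp (-(1 / gk ^ 2) * GF V + A V))
    (hχ1 : ∀ V, (∀ b : PBond (F.P K) k, ¬ IsB0 b → dist1 ((crit ((avOfRecord F N K k).avg V) b)⁻¹ * V b) < ε₁) → χ V = 1)
    (hχ0 : ∀ V, ¬ (∀ b : PBond (F.P K) k, ¬ IsB0 b → dist1 ((crit ((avOfRecord F N K k).avg V) b)⁻¹ * V b) < ε₁) → χ V = 0)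
    {U : GaugeField (F.P K) k (SU N)} (hcrit : ContinuousAt (fun V : GaugeField (F.P K) k (SU N) => crit ((avOfRecord F N K k).avg V)) U)
    (hne : ∀ b : PBond (F.P K) k, ¬ IsB0 b → dist1 ((crit ((avOfRecord F N K k).avg U) b)⁻¹ * U b) ≠ ε₁)
    (hGF : ContinuousAt GF U) (hA : ContinuousAt A U) : ContinuousAt ρ U := by
  have e : ρ = fun V => χ V * Real.exp (-(1 / gk ^ 2) * GF V + A V) := funext hρ
  rw [e]
  have hχc : ContinuousAt χ U := (continuousAt_const (y := χ U)).congr_of_eventuallyEq (eventuallyEq_cut_of_forall_ne hχ1 hχ0 hcrit hne)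
  exact hχc.mul (Real.continuous_exp.continuousAt.comp ((continuousAt_const.mul hGF).add hA))

/-! ## §2 FILE 1∕3's LOCAL clauses `hρc` and `hρC` for an arbitrary letter -/

/-- ★★★ **FILE 1∕3's LOCAL CONTINUITY CLAUSE FOR AN ARBITRARY LETTER**: `crit` continuous ON an open `D` of coarse fields, `GF`, `A` continuous on an open `Dk ⊇ K₀`, `K₀` in the loop
α-guard with `α < δ_N` (so the averaging of record is continuous at its points, dag-n09-w4's `continuousAt_avgFun_of_small`), `ρ = χ·exp[−GF∕g² + A]` cut at the thresholds of `crit` ⇒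
`∀ U ∈ K₀, Ū U ∈ D → (∀ b, (∀ c, β(c) ≠ b) → dist1 (crit(Ū U)(b)⁻¹·U(b)) ≠ ε₁) → ContinuousAt ρ U`. [cite: Balaban1987RG1, (0.4) p.253, (0.19) p.255, (2.3) p.265 and (2.9) p.266] -/
theorem hρc_local_of_continuousOn_crit {ε₁ gk : ℝ} {χ GF A ρ : Density (F.P K) k (SU N)}
    (hρ : ∀ V, ρ V = χ V * Real.exp (-(1 / gk ^ 2) * GF V + A V))
    (hχ1 : ∀ V, (∀ b : PBond (F.P K) k, ¬ IsB0 b → dist1 ((crit ((avOfRecord F N K k).avg V) b)⁻¹ * V b) < ε₁) → χ V = 1)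
    (hχ0 : ∀ V, ¬ (∀ b : PBond (F.P K) k, ¬ IsB0 b → dist1 ((crit ((avOfRecord F N K k).avg V) b)⁻¹ * V b) < ε₁) → χ V = 0)
    {K₀ Dk : Set (GaugeField (F.P K) k (SU N))} {D : Set (GaugeField (F.P K) (k + 1) (SU N))} (hD : IsOpen D) (hDk : IsOpen Dk) (hK₀Dk : K₀ ⊆ Dk)
    {α : ℝ} (hαδ : α < deltaSU (Fin N)) (hK₀α : ∀ U ∈ K₀, ∀ c (i : Idx (F.P K)), dist1 (loopHol U c i) ≤ α)
    (hcrit : ContinuousOn crit D) (hGF : ContinuousOn GF Dk) (hA : ContinuousOn A Dk) :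
    ∀ U ∈ K₀, (avOfRecord F N K k).avg U ∈ D →
      (∀ b : PBond (F.P K) k, (∀ c : PBond (F.P K) (k + 1), centralBond c ≠ b) → dist1 ((crit ((avOfRecord F N K k).avg U) b)⁻¹ * U b) ≠ ε₁) →
        ContinuousAt ρ U := by
  intro U hU hUD hne
  have hsmall : ∀ c, Small (expMeanLogSU (n := Fin N)) U c := fun c i => lt_of_le_of_lt (hK₀α U hU c i) hαδ
  have havg : ContinuousAt (avOfRecord F N K k).avg U := continuousAt_avgFun_of_small (P := F.P K) (j := k) U hsmall
  have hcritU : ContinuousAt (fun V : GaugeField (F.P K) k (SU N) => crit ((avOfRecord F N K k).avg V)) U :=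
    ContinuousAt.comp (f := (avOfRecord F N K k).avg) (hcrit.continuousAt (hD.mem_nhds hUD)) havg
  exact continuousAt_density_of_forall_ne hρ hχ1 hχ0 hcritU (fun b hb => hne b ((not_isB0_iff b).1 hb))
    (hGF.continuousAt (hDk.mem_nhds (hK₀Dk hU))) (hA.continuousAt (hDk.mem_nhds (hK₀Dk hU)))

omit [NeZero N] in
/-- ★★ **FILE 1∕3's BOUNDEDNESS CLAUSE FOR ANY DENSITY `ρ = χ·exp[−GF∕g² + A]` WITH `0 ≤ χ ≤ 1`**: on every CLOSED `K₀ ⊆ Dk` with `GF`, `A` continuous on `Dk`, `∃ C₀, ∀ U ∈ K₀, ρ U ≤ C₀`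
(compactness of `SU(N)^{bonds}`). [cite: Balaban1987RG1, (0.19) p.255 and p.259 (bookkeeping)] -/
theorem hρC_of_cut_le_one_of_continuousOn {gk : ℝ} {χ GF A ρ : Density (F.P K) k (SU N)}
    (hρ : ∀ V, ρ V = χ V * Real.exp (-(1 / gk ^ 2) * GF V + A V)) (hχ1 : ∀ V, χ V ≤ 1)
    {K₀ Dk : Set (GaugeField (F.P K) k (SU N))} (hK₀ : IsClosed K₀) (hK₀Dk : K₀ ⊆ Dk)
    (hGF : ContinuousOn GF Dk) (hA : ContinuousOn A Dk) :
    ∃ C₀ : ℝ, ∀ U ∈ K₀, ρ U ≤ C₀ := by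
  haveI : CompactSpace (GaugeField (F.P K) k (SU N)) := inferInstanceAs (CompactSpace (PBond (F.P K) k → SU N))
  have hcont : ContinuousOn (fun U : GaugeField (F.P K) k (SU N) => Real.exp (-(1 / gk ^ 2) * GF U + A U)) K₀ :=
    (Real.continuous_exp.comp_continuousOn ((continuousOn_const.mul hGF).add hA)).mono hK₀Dk
  obtain ⟨C, hC⟩ := hK₀.isCompact.exists_bound_of_continuousOn hcont
  refine ⟨C, fun U hU => ?_⟩
  rw [hρ U]
  calc χ U * Real.exp (-(1 / gk ^ 2) * GF U + A U) ≤ 1 * Real.exp (-(1 / gk ^ 2) * GF U + A U) :=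
        mul_le_mul_of_nonneg_right (hχ1 U) (Real.exp_pos _).le
    _ ≤ C := by
        rw [one_mul]
        exact (Real.le_norm_self _).trans (hC U hU)

end Generic

/-! ## §3 Sel edition (the OFFER `critCfgSelOfRecord` ∕ `chiFixed29Sel`) -/

/-- **Sel EDITION of the LOCAL continuity clause**: `ρ_k := betaInputOfRecord T (chiFixed29Sel ν ε₁) K g k`, exemption via `Node00.fluctDevSelOfRecord`; `hcrit : ContinuousOn
(critCfgSelOfRecord ν K k) D` is dag-n09-w1 g6's theorem at `D := domAlt_{k+1}` from [B11] Thm 1's two-radii binders. [cite: Balaban1987RG1, (0.19) p.255, (2.3) p.265 and (2.9) p.266; Balaban1985Variational, Thm 1 p.279] -/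
theorem hρc_betaInput_chi29Sel_local_of_continuousOn_crit (ν : Stage7Numerics) (ε₁ : ℝ) (T : Transport F N) (g : ℕ → ℝ)
    {K₀ Dk : Set (GaugeField (F.P K) k (SU N))} {D : Set (GaugeField (F.P K) (k + 1) (SU N))} (hD : IsOpen D) (hDk : IsOpen Dk) (hK₀Dk : K₀ ⊆ Dk)
    {α : ℝ} (hαδ : α < deltaSU (Fin N)) (hK₀α : ∀ U ∈ K₀, ∀ c (i : Idx (F.P K)), dist1 (loopHol U c i) ≤ α)
    (hcrit : ContinuousOn (critCfgSelOfRecord F N ν K k) D)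
    (hGF : ContinuousOn (gfOfRecord F N K k) Dk) (hA : ContinuousOn (effActionHT F N T (chiFixed29Sel F N ν ε₁) K g k) Dk) :
    ∀ U ∈ K₀, (avOfRecord F N K k).avg U ∈ D →
      (∀ b : PBond (F.P K) k, (∀ c : PBond (F.P K) (k + 1), centralBond c ≠ b) → fluctDevSelOfRecord F N ν K k U b ≠ ε₁) →
        ContinuousAt (betaInputOfRecord F N T (chiFixed29Sel F N ν ε₁) K g k) U := by
  intro U hU hUD hne
  refine hρc_local_of_continuousOn_crit (crit := critCfgSelOfRecord F N ν K k) (χ := chiFix29SelOfRecord F N ν ε₁ K k)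
    (GF := gfOfRecord F N K k) (A := effActionHT F N T (chiFixed29Sel F N ν ε₁) K g k) (gk := g k) (fun _ => rfl)
    (fun V hV => (chiFix29SelOfRecord_eq_one_iff ν ε₁ K k V).2 fun b hb => by rw [fluctDevSelOfRecord_apply]; exact hV b hb)
    (fun V hV => ?_) hD hDk hK₀Dk hαδ hK₀α hcrit hGF hA U hU hUD (fun b hb => by rw [← fluctDevSelOfRecord_apply]; exact hne b hb)
  rcases chiFix29SelOfRecord_eq_zero_or_one ν ε₁ K k V with h | h
  · exact h
  · exact absurd (fun b hb => by rw [← fluctDevSelOfRecord_apply]; exact (chiFix29SelOfRecord_eq_one_iff ν ε₁ K k V).1 h b hb) hV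

/-- **Sel EDITION of the boundedness clause** (`0 ≤ χ^{(2.9),Sel} ≤ 1`). [cite: Balaban1987RG1, (0.19) p.255 (bookkeeping)] -/
theorem hρC_betaInput_chi29Sel_of_continuousOn (ν : Stage7Numerics) (ε₁ : ℝ) (T : Transport F N) (g : ℕ → ℝ)
    {K₀ Dk : Set (GaugeField (F.P K) k (SU N))} (hK₀ : IsClosed K₀) (hK₀Dk : K₀ ⊆ Dk)
    (hGF : ContinuousOn (gfOfRecord F N K k) Dk) (hA : ContinuousOn (effActionHT F N T (chiFixed29Sel F N ν ε₁) K g k) Dk) :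
    ∃ C₀ : ℝ, ∀ U ∈ K₀, betaInputOfRecord F N T (chiFixed29Sel F N ν ε₁) K g k U ≤ C₀ :=
  hρC_of_cut_le_one_of_continuousOn (χ := chiFix29SelOfRecord F N ν ε₁ K k) (gk := g k) (fun _ => rfl)
    (fun V => (chiFix29SelOfRecord_mem_Icc ν ε₁ K k V).2) hK₀ hK₀Dk hGF hA

end Summit.QuantumFields.YangMills.BalabanUVNodes.N09DensityContinuousOffThresholdsAnyCrit

end
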